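import Literature.Geometry.Lorentzian.KerrKillingTangency
import Literature.Geometry.Lorentzian.KerrIngoingCoordKretschmann
import Literature.Geometry.Lorentzian.SchwarzschildStaticChart
import HarnessLib

/-!
# Killing fields of the Schwarzschild exterior in the Kerr–Schild chart: coordinate equation,
# radial tangency, and the model fields `α ∂_{t*} + (0, W x⃗)`

Infrastructure (everything proved; the only definitions are the explicit model fields) for the
named fact `Literature.Geometry.Lorentzian.StephaniEtAl2003_schwarzschildKillingFields`
(`SchwarzschildKillingAlgebra.lean`; Stephani–Kramer–MacCallum–Hoenselaers–Herlt, *Exact Solutions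
of Einstein's Field Equations* (2003), §15.4 with §38.2: the Killing algebra of the Schwarzschild
exterior is `ℝ ∂_t ⊕ so(3)`), in the ingoing Eddington–Finkelstein / Kerr–Schild Cartesian chart of
the tree (`Kerr.bilin M 0`, `Kerr.exterior M 0 = {‖x⃗‖ > 2M}`):

* §1 `Schwarzschild.coordRepr` — the coordinate representative `Xf` of a Killing field `X` of
  `Kerr.smoothMetric M 0 r₊` (extended by `0`), `C^∞` on the exterior and solving the coordinate
  Killing equation `DG(Xf)(·,·) + G(DXf ·,·) + G(·, DXf ·) = 0` (`Kerr.killing_coord_lie_eq_zero`);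
* §2 `Schwarzschild.rmNormSqAt_bilin_zero` — the Kretschmann scalar `|Rm|² = 48 M²/r⁶` of the
  Schwarzschild components (the `a = 0` case of the tree's Kerr closed form, by transport from the
  ingoing chart), and **radial tangency** `Schwarzschild.sdot_eq_zero_of_killing`: a solution of
  the coordinate Killing equation annihilates `|Rm|²` (`MetricCoord.fderiv_rmNormSqAt_apply_eq_zero`),
  hence `⟪x⃗, X⃗(x)⟫ = 0` for `M ≠ 0` (O'Neill 1995, §3.7: "`r` is an isometric invariant");
* §3 the model fields: `Schwarzschild.skewGen b c d` (the general element of `so(3)` acting on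
  `E3`), `Schwarzschild.rotCLM W = (0, W x⃗)` and the verification that `∂_{t*}` and every
  `(0, W x⃗)`, `W` skew, solve the coordinate Killing equation of `Kerr.bilin M 0`
  (`killingEq_basisVector_zero`, `killingEq_rotCLM`; stationarity and spherical symmetry);
* §4 the first and second derivatives of `h(y) = ⟪y⃗, Y(y)⟫` at a zero of `Y`
  (`fderiv_sdot_apply_of_apply_eq_zero`, `fderiv_fderiv_sdot_apply`), the raw
  form of the radial-tangency constraints on the 1-jet and 2-jet of a Killing field at a zero.

## References

* H. Stephani, D. Kramer, M. MacCallum, C. Hoenselaers, E. Herlt, *Exact Solutions of Einstein's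
  Field Equations*, 2nd ed., CUP 2003, §15.4 (15.19), §38.2. [StephaniEtAl2003]
* B. O'Neill, *The Geometry of Kerr Black Holes*, A K Peters 1995, §3.7. [ONeill1995]
* B. O'Neill, *Semi-Riemannian Geometry*, Academic Press 1983, Ch. 9, Prop. 9.25. [ONeill1983]
-/

noncomputable section

set_option maxSynthPendingDepth 3

open Set Filter Function Metric
open scoped Topology ContDiff Manifold RealInnerProductSpace
open Literature.Geometry.Lorentzian.MetricCoord

namespace Literature.Geometry.Lorentzian

namespace Schwarzschild

variable {M : ℝ} {x : E4}

/-! ### §1 The coordinate representative of a Killing field and its Killing equation -/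

/-- The coordinate representative of a vector field on the Schwarzschild exterior chart, extended
by `0` off the chart. [folklore] -/
def coordRepr (M : ℝ) (X : Π y : Kerr.exterior M 0, TangentSpace 𝓘(ℝ, E4) y) (y : E4) : E4 :=
  by classical exact if h : y ∈ Kerr.exterior M 0 then (X ⟨y, h⟩ : E4) else 0

/-- On the chart the representative is the field. [folklore] -/
theorem coordRepr_eq (X : Π y : Kerr.exterior M 0, TangentSpace 𝓘(ℝ, E4) y) (y : Kerr.exterior M 0) :
    X y = coordRepr M X y := by
  unfold coordRepr
  simp only [y.2, dite_true]

section Killing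

variable [Kerr.Facts] [(Kerr.smoothMetric M 0 (Kerr.rPlus M 0)).HasLeviCivita]
  {X : Π y : Kerr.exterior M 0, TangentSpace 𝓘(ℝ, E4) y}
  (hX : (Kerr.smoothMetric M 0 (Kerr.rPlus M 0)).toPseudoRiemannianMetric.IsKillingField X)
include hX

/-- **A Killing field of the Schwarzschild exterior is `C^∞` in coordinates.** [folklore] -/
theorem contDiffOn_coordRepr : ContDiffOn ℝ ∞ (coordRepr M X) (Kerr.exterior M 0) :=
  fun y hy ↦ (hX.contDiffAt_coordRepr (coordRepr_eq X) ⟨y, hy⟩).contDiffWithinAt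

/-- **The coordinate Killing equation** of a Killing field of the Schwarzschild exterior:
`DG_y(Xf y)(v, w) + G_y(DXf v, w) + G_y(v, DXf w) = 0`, `G = Kerr.bilin M 0`.
O'Neill 1983, Ch. 9, Prop. 9.25. [cite: ONeill1983, Ch. 9, Prop. 9.25] -/
theorem killingEq_coordRepr : ∀ y ∈ (Kerr.exterior M 0 : Set E4), ∀ v w : E4,
    fderiv ℝ (Kerr.bilin M 0) y (coordRepr M X y) v w + Kerr.bilin M 0 y (fderiv ℝ (coordRepr M X) y v) w +
      Kerr.bilin M 0 y v (fderiv ℝ (coordRepr M X) y w) = 0 :=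
  fun y hy v w ↦ Kerr.killing_coord_lie_eq_zero M 0 (Kerr.rPlus M 0) hX (coordRepr_eq X) ⟨y, hy⟩ v w

end Killing

/-! ### §2 The Kretschmann scalar of Schwarzschild and radial tangency of Killing fields -/

/-- **The Kretschmann scalar of the Schwarzschild components**: `|Rm|²(Kerr.bilin M 0)(x) = 48 M²/r⁶`,
`r = ‖x⃗‖ > 0` — the `a = 0` case of the Kerr closed form `48 M² Re (r + ia cos θ)⁶/Σ⁶`, by transport
from the ingoing chart (`Kerr.rmNormSqAt_kerrBilin_of_ingoing`, `Kerr.Ingoing.rmNormSqAt_bilin`).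
Stephani et al. 2003, §15.4; Visser arXiv:0706.0622, §3. [cite: arXiv07060622, §3] -/
theorem rmNormSqAt_bilin_zero (M : ℝ) (hx : 0 < Kerr.radius 0 x) :
    rmNormSqAt (Kerr.bilin M 0) x = 48 * M ^ 2 / E4.spatialNorm x ^ 6 := by
  have h := Kerr.rmNormSqAt_kerrBilin_of_ingoing M 0 (fun u hu ↦ ?_) x hx
  · rw [h, Kerr.radius_zero_left]
    rw [Kerr.radius_zero_left] at hx
    have hr : E4.spatialNorm x ≠ 0 := hx.ne'
    simp only [zero_mul, Complex.ofReal_zero, zero_mul, add_zero, ← Complex.ofReal_pow,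
      Complex.ofReal_re]
    field_simp
    ring
  · rw [Kerr.Ingoing.rmNormSqAt_bilin M 0 (Kerr.Ingoing.mem_regularSet_of_mem_coordDomain hu)]
    simp only [Kerr.Ingoing.sigma]
    ring

/-- **A solution of the coordinate Killing equation of Schwarzschild is tangent to the spheres
`{r = const}`**: if `Xf` is `C^∞` on the exterior and `𝓛_{Xf} G = 0` there (`G = Kerr.bilin M 0`,
`M ≠ 0`), then `⟪x⃗, X⃗f(x)⟫ = 0` on the exterior — `Xf` annihilates the Kretschmann scalar
`48 M²/r⁶` (`MetricCoord.fderiv_rmNormSqAt_apply_eq_zero`), whose radial derivative does not vanish.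
O'Neill 1995, §3.7 ("`r` is an isometric invariant"); Stephani et al. 2003, §15.4.
[cite: ONeill1995, Ch. 3 §3.7] -/
theorem sdot_eq_zero_of_killingEq (hM : M ≠ 0) {Xf : E4 → E4}
    (hXf : ContDiffOn ℝ ∞ Xf (Kerr.exterior M 0))
    (hK : ∀ y ∈ (Kerr.exterior M 0 : Set E4), ∀ v w : E4,
      fderiv ℝ (Kerr.bilin M 0) y (Xf y) v w + Kerr.bilin M 0 y (fderiv ℝ Xf y v) w +
        Kerr.bilin M 0 y v (fderiv ℝ Xf y w) = 0)
    (hx : x ∈ Kerr.exterior M 0) : sdot x (Xf x) = 0 := by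
  have hV : IsMetricOn (Kerr.bilin M 0) (Kerr.exterior M 0 : Set E4) := KerrSchildChart.isMetricOn_kerrBilin M 0 _
  have h0 := fderiv_rmNormSqAt_apply_eq_zero hV hXf hK hx
  have hsp : E4.spatial x ≠ 0 := spatial_ne_zero_of_mem hx
  have hr : E4.spatialNorm x ≠ 0 := by rwa [E4.spatialNorm, norm_ne_zero_iff]
  -- the Kretschmann scalar is `48 M²/r⁶` near `x`
  have heq : rmNormSqAt (Kerr.bilin M 0) =ᶠ[𝓝 x] fun y ↦ 48 * M ^ 2 / E4.spatialNorm y ^ 6 := by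
    filter_upwards [(Kerr.exterior M 0).isOpen.mem_nhds hx] with y hy
    exact rmNormSqAt_bilin_zero M (Kerr.radius_pos_of_mem_region hy)
  rw [heq.fderiv_eq, (hasFDerivAt_const_div_spatialNorm_pow (48 * M ^ 2) hsp 6).fderiv] at h0
  simp only [FunLike.coe_smul, Pi.smul_apply, sdotCLM_apply, smul_eq_mul, mul_eq_zero] at h0
  rcases h0 with h0 | h0
  · exfalso
    have : (48 : ℝ) * M ^ 2 * 6 ≠ 0 := by positivity
    rw [div_eq_zero_iff, neg_eq_zero] at h0
    rcases h0 with h0 | h0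
    · exact this (by exact_mod_cast h0)
    · exact pow_ne_zero _ hr h0
  · exact h0

/-! ### §3 The model Killing fields: `∂_{t*}` and the rotations `(0, W x⃗)` -/

/-- The underlying linear map of `skewGen`. [folklore] -/
def skewGenLin (b c d : ℝ) : E3 →ₗ[ℝ] E3 where
  toFun y := !₂[-(b * y 1) - c * y 2, b * y 0 - d * y 2, c * y 0 + d * y 1]
  map_add' y z := by
    ext i
    fin_cases i <;> simp <;> ring
  map_smul' t y := by
    ext i
    fin_cases i <;> simp <;> ring

/-- **The general infinitesimal rotation of `ℝ³`**: the skew-adjoint map with matrix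
`((0, −b, −c), (b, 0, −d), (c, d, 0))`, `W y⃗ = ω⃗ × y⃗` with `ω⃗ = (d, −c, b)`; every element of
`so(3)` is of this form. [folklore] -/
def skewGen (b c d : ℝ) : E3 →L[ℝ] E3 := LinearMap.toContinuousLinearMap (skewGenLin b c d)

/-- Component `0` of `skewGen`. [folklore] -/
@[simp] theorem skewGen_apply_zero (b c d : ℝ) (y : E3) : skewGen b c d y 0 = -(b * y 1) - c * y 2 := by
  simp [skewGen, skewGenLin]

/-- Component `1` of `skewGen`. [folklore] -/
@[simp] theorem skewGen_apply_one (b c d : ℝ) (y : E3) : skewGen b c d y 1 = b * y 0 - d * y 2 := by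
  simp [skewGen, skewGenLin]

/-- Component `2` of `skewGen`. [folklore] -/
@[simp] theorem skewGen_apply_two (b c d : ℝ) (y : E3) : skewGen b c d y 2 = c * y 0 + d * y 1 := by
  simp [skewGen, skewGenLin]

/-- `skewGen b c d` is skew-adjoint: `⟪W u, v⟫ = −⟪u, W v⟫`. [folklore] -/
theorem inner_skewGen (b c d : ℝ) (u v : E3) : ⟪skewGen b c d u, v⟫ = -⟪u, skewGen b c d v⟫ := by
  rw [Kerr.Ingoing.inner_e3, Kerr.Ingoing.inner_e3]
  simp only [skewGen_apply_zero, skewGen_apply_one, skewGen_apply_two]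
  ring

/-- `skewGen` is additive in its parameters. [folklore] -/
theorem skewGen_add (b c d b' c' d' : ℝ) :
    skewGen (b + b') (c + c') (d + d') = skewGen b c d + skewGen b' c' d' := by
  ext y i
  fin_cases i <;> simp <;> ring

/-- **The rotation field** `x ↦ (0, W x⃗)` of `E4` generated by a linear map `W` of `ℝ³`, as a
continuous linear map (it is its own derivative). [folklore] -/
def rotCLM (W : E3 →L[ℝ] E3) : E4 →L[ℝ] E4 := E4.spaceEmbed.comp (W.comp E4.spatial)

/-- `rotCLM W x = (0, W x⃗)`. [folklore] -/
theorem rotCLM_apply (W : E3 →L[ℝ] E3) (y : E4) : rotCLM W y = E4.ofTimeSpace 0 (W (E4.spatial y)) := rfl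

/-- The time component of `rotCLM W y` vanishes. [folklore] -/
@[simp] theorem rotCLM_apply_time (W : E3 →L[ℝ] E3) (y : E4) : rotCLM W y 0 = 0 := rfl

/-- The spatial part of `rotCLM W y` is `W y⃗`. [folklore] -/
@[simp] theorem spatial_rotCLM (W : E3 →L[ℝ] E3) (y : E4) : E4.spatial (rotCLM W y) = W (E4.spatial y) := by
  rw [rotCLM_apply, E4.spatial_ofTimeSpace]

/-- `rotCLM` is additive in `W`. [folklore] -/
theorem rotCLM_add (W W' : E3 →L[ℝ] E3) : rotCLM (W + W') = rotCLM W + rotCLM W' := by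
  simp only [rotCLM, ContinuousLinearMap.add_comp, ContinuousLinearMap.comp_add]

/-- `rotCLM` commutes with scalars. [folklore] -/
theorem rotCLM_smul (t : ℝ) (W : E3 →L[ℝ] E3) : rotCLM (t • W) = t • rotCLM W := by
  simp only [rotCLM, ContinuousLinearMap.smul_comp, ContinuousLinearMap.comp_smul]

/-- `⟪x⃗, W x⃗⟫ = 0` for skew `W`: the rotation fields are tangent to the spheres. [folklore] -/
theorem sdot_rotCLM_self {W : E3 →L[ℝ] E3} (hW : ∀ u v : E3, ⟪W u, v⟫ = -⟪u, W v⟫) (y : E4) :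
    sdot y (rotCLM W y) = 0 := by
  rw [sdot, spatial_rotCLM]
  have h := hW (E4.spatial y) (E4.spatial y)
  rw [real_inner_comm] at h
  linarith

/-- **`∂_{t*}` solves the coordinate Killing equation of Schwarzschild** (stationarity:
`∂_{t*} g_{μν} = 0`, and `∂_{t*}` has constant components). [cite: ONeill1995, Ch. 2 §2.2] -/
theorem killingEq_basisVector_zero (M : ℝ) (hx : x ∈ Kerr.exterior M 0) (v w : E4) :
    fderiv ℝ (Kerr.bilin M 0) x (E4.basisVector 0) v w +
      Kerr.bilin M 0 x (fderiv ℝ (fun _ : E4 ↦ E4.basisVector 0) x v) w +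
      Kerr.bilin M 0 x v (fderiv ℝ (fun _ : E4 ↦ E4.basisVector 0) x w) = 0 := by
  rw [Kerr.fderiv_bilin_basisVector_zero M 0 (Kerr.differentiableAt_bilin M 0 ⟨x, hx⟩)]
  simp

/-- **The rotation fields `(0, W x⃗)`, `W ∈ so(3)`, solve the coordinate Killing equation of
Schwarzschild** (spherical symmetry of `g = η + (2M/r) ℓ ⊗ ℓ`, `ℓ = (1, x⃗/r)`: `∂_{(0,Wx⃗)} r = 0`,
`∂_{(0,Wx⃗)} ℓ = (0, W ·⃗/r)` is compensated by `ℓ ∘ (0 ⊕ W)` through skewness). Stephani et al.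
2003, §15.4 (the `G₃` of rotations). [cite: StephaniEtAl2003, §15.4 (15.19)] -/
theorem killingEq_rotCLM (M : ℝ) {W : E3 →L[ℝ] E3} (hW : ∀ u v : E3, ⟪W u, v⟫ = -⟪u, W v⟫)
    (hx : E4.spatial x ≠ 0) (v w : E4) :
    fderiv ℝ (Kerr.bilin M 0) x (rotCLM W x) v w + Kerr.bilin M 0 x (rotCLM W v) w +
      Kerr.bilin M 0 x v (rotCLM W w) = 0 := by
  have hr : E4.spatialNorm x ≠ 0 := by rwa [E4.spatialNorm, norm_ne_zero_iff]
  rw [fderiv_bilin_zero_spin_apply M hx, bilin_zero_eq M hx, bilin_zero_eq M hx]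
  -- the inner-product atoms and the skewness relations between them
  have h1 : sdot x (rotCLM W x) = 0 := sdot_rotCLM_self hW x
  have h2 : sdot (rotCLM W v) w = -sdot v (rotCLM W w) := by
    rw [sdot, sdot, spatial_rotCLM, spatial_rotCLM]; exact hW _ _
  have h3 : sdot v (rotCLM W x) = -sdot x (rotCLM W v) := by
    rw [sdot, sdot, spatial_rotCLM, spatial_rotCLM, real_inner_comm, hW, real_inner_comm]
  have h4 : sdot w (rotCLM W x) = -sdot x (rotCLM W w) := by
    rw [sdot, sdot, spatial_rotCLM, spatial_rotCLM, real_inner_comm, hW, real_inner_comm]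
  simp only [dG, dEll, ell, rotCLM_apply_time, h1, zero_add, zero_mul, mul_zero, zero_div, neg_zero,
    sub_zero]
  rw [h2, h3, h4]
  field_simp
  ring

/-! ### §4 Derivatives of `h(y) = ⟪y⃗, Y⃗(y)⟫` at a zero of `Y` -/

/-- The spatial pairing `(y, z) ↦ ⟪y⃗, z⃗⟫` as a continuous bilinear form on `E4`. [folklore] -/
def sdotBilin : E4 →L[ℝ] E4 →L[ℝ] ℝ := (innerSL ℝ (E := E3)).bilinearComp E4.spatial E4.spatial

/-- `sdotBilin y z = ⟪y⃗, z⃗⟫`. [folklore] -/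
@[simp] theorem sdotBilin_apply (y z : E4) : sdotBilin y z = sdot y z := by
  simp [sdotBilin, sdot]

/-- **First derivative of `h = ⟪y⃗, Y⃗⟫`**: `Dh_y(v) = ⟪y⃗, DY_y v⟫ + ⟪v⃗, Y y⟫` wherever `Y` is
differentiable. [folklore] -/
theorem hasFDerivAt_sdot_apply {Y : E4 → E4} {Y' : E4 →L[ℝ] E4} {y : E4} (hY : HasFDerivAt Y Y' y) :
    HasFDerivAt (fun z ↦ sdot z (Y z)) ((sdotBilin y).comp Y' + sdotBilin.flip (Y y)) y := by
  have h := (sdotBilin.hasFDerivAt (x := y)).clm_apply hY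
  simpa using h

/-- **At a zero of `Y`**: `Dh_y(v) = ⟪y⃗, DY_y v⟫`. [folklore] -/
theorem fderiv_sdot_apply_of_apply_eq_zero {Y : E4 → E4} {y : E4} (hY : DifferentiableAt ℝ Y y)
    (h0 : Y y = 0) (v : E4) :
    fderiv ℝ (fun z ↦ sdot z (Y z)) y v = sdot y (fderiv ℝ Y y v) := by
  rw [(hasFDerivAt_sdot_apply hY.hasFDerivAt).fderiv]
  simp [h0]

/-- **Second derivative of `h = ⟪y⃗, Y⃗⟫`**:
`D²h_y(u, v) = ⟪y⃗, D²Y_y(u, v)⟫ + ⟪u⃗, DY_y v⟫ + ⟪v⃗, DY_y u⟫` for `Y` of class `C²` near `y` (the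
pairing is bilinear, so no second derivative of it appears). [folklore] -/
theorem fderiv_fderiv_sdot_apply {Y : E4 → E4} {y : E4} {s : Set E4} (hs : IsOpen s)
    (hys : y ∈ s) (hY : ContDiffOn ℝ 2 Y s) (u v : E4) :
    fderiv ℝ (fderiv ℝ (fun z ↦ sdot z (Y z))) y u v =
      sdot y (fderiv ℝ (fderiv ℝ Y) y u v) + sdot u (fderiv ℝ Y y v) + sdot v (fderiv ℝ Y y u) := by
  have hys' : s ∈ 𝓝 y := hs.mem_nhds hys
  have hYd : ∀ z ∈ s, DifferentiableAt ℝ Y z := fun z hz ↦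
    (hY.differentiableOn two_ne_zero).differentiableAt (hs.mem_nhds hz)
  have hY'd : DifferentiableAt ℝ (fderiv ℝ Y) y :=
    ((hY.fderiv_of_isOpen hs (m := 1) (by norm_num)).differentiableOn one_ne_zero).differentiableAt hys'
  -- `Dh = h'` near `y`
  set h' : E4 → E4 →L[ℝ] ℝ := fun z ↦ (sdotBilin z).comp (fderiv ℝ Y z) + sdotBilin.flip (Y z) with hh'
  have heq : fderiv ℝ (fun z ↦ sdot z (Y z)) =ᶠ[𝓝 y] h' := by
    filter_upwards [hys'] with z hz
    exact (hasFDerivAt_sdot_apply (hYd z hz).hasFDerivAt).fderiv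
  rw [heq.fderiv_eq]
  -- differentiate `h'`
  have h1 : HasFDerivAt (fun z ↦ (sdotBilin z).comp (fderiv ℝ Y z))
      (((ContinuousLinearMap.compL ℝ E4 E4 ℝ) (sdotBilin y)).comp (fderiv ℝ (fderiv ℝ Y) y) +
        ((ContinuousLinearMap.compL ℝ E4 E4 ℝ).flip (fderiv ℝ Y y)).comp sdotBilin) y :=
    (sdotBilin.hasFDerivAt (x := y)).clm_comp hY'd.hasFDerivAt
  have h2 : HasFDerivAt (fun z ↦ sdotBilin.flip (Y z)) (sdotBilin.flip.comp (fderiv ℝ Y y)) y :=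
    sdotBilin.flip.hasFDerivAt.comp y (hYd y hys).hasFDerivAt
  have h3 : HasFDerivAt h'
      (((ContinuousLinearMap.compL ℝ E4 E4 ℝ) (sdotBilin y)).comp (fderiv ℝ (fderiv ℝ Y) y) +
        ((ContinuousLinearMap.compL ℝ E4 E4 ℝ).flip (fderiv ℝ Y y)).comp sdotBilin +
        sdotBilin.flip.comp (fderiv ℝ Y y)) y := h1.add h2
  rw [h3.fderiv]
  simp only [add_apply, ContinuousLinearMap.comp_apply, ContinuousLinearMap.flip_apply,
    ContinuousLinearMap.compL_apply, sdotBilin_apply]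

/-- If `h` vanishes near `y`, so do `Dh_y` and `D²h_y`. [folklore] -/
theorem fderiv_fderiv_eq_zero_of_eventuallyEq_zero {h : E4 → ℝ} {y : E4} (hh : h =ᶠ[𝓝 y] fun _ ↦ 0) :
    fderiv ℝ h y = 0 ∧ fderiv ℝ (fderiv ℝ h) y = 0 := by
  have h1 : fderiv ℝ h =ᶠ[𝓝 y] fun _ ↦ (0 : E4 →L[ℝ] ℝ) := by
    filter_upwards [hh.eventuallyEq_nhds] with z hz
    rw [hz.fderiv_eq, fderiv_fun_const]
    rfl
  refine ⟨?_, ?_⟩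
  · have := h1.self_of_nhds; exact this
  · rw [h1.fderiv_eq, fderiv_fun_const]
    rfl

end Schwarzschild

end Literature.Geometry.Lorentzian

end
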